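/-
Copyright (c) 2026 the pub-hodgecm-mathlib formalisation cell (harness21).  Prover seat hodgecm-mathlib-F0P2-p10 (g4), Track B ∕ R90-TF, h413 = `stmt-HodgeConjecture-24833`,
R90-TF section S8 «ContSpec-n½», socket (E) :276, E1-PLANCHEREL BODY brick PB-1b-i (S8 dealer R90-CS-plan (g4) S8-R254 (8)+(9); §PB-1 census `R90/S8/CENSUS-PlancherelBody-PB1.F0P2-p10-g4.md`):
the DIAGONAL BRACKET `[Ψ₁]_β` of the unfolded inner product of two twisted pseudo-Eisenstein series with the SAME unitary pair data on `U(2,1)_{L∕L⁺}`, pushed to the idele classes —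
`[Ψ₁]_β = K · ⟪φ,φ′⟫_{K_U} · ∫_{𝓕_I} ‖x‖⁻² (f·conj f′)(‖x‖) dν_I` (sequel of ★ PB-1a p865168; Mellin side = PB-1b-ii).
-/
import Summits.HodgeConjecture.HodgeConjecture.Theorems.K2E1ChiPseudoEisensteinWeightBracketsCMThree       -- ★ C4a p86xxxx (K2E1-p13): the template `integral_weight_smul_wOne_eq_zero_cm_three`; brings ★ C1 `integral_maximalCompact_torus_chiSectionPair_mul_conj`, ★ (δ)₃, ★ GR-χ, ★ C3
import HarnessLib

/-!
# PB-1b-i — `K2E1ChiPseudoEisensteinBracketOneIdeleCMThree`: THE DIAGONAL BRACKET `[Ψ₁]_β = K·⟪φ,φ′⟫_{K_U}·∫_{E^×∖𝕀_E} ‖x‖⁻²•(f·conj f′)(‖x‖) dν_I` FOR THE SAME UNITARY PAIR DATA ON `U(2,1)_{L∕L⁺}`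

Track B ∕ R90-TF, crux h413 = `stmt-HodgeConjecture-24833`, route of record `HCCMUnconditional`; cell `hodgecm-mathlib`, R90-TF programme, section S8 «ContSpec-n½», socket (E)
(B ED. 7 :276): the E1-PLANCHEREL BODY (census-E4 row (5)) cut into bricks PB-1…PB-4 (S8-R254).  ★ PB-1a p865168 `chiPseudoEisenstein_inner_product_eq_brackets_cm_three` gives
`⟨θ_{f,φ}, θ_{f′,φ′}⟩_X = c_μ·([Ψ₁]_β + [Ψ₂]_β)`; THIS FILE evaluates the DIAGONAL bracket `[Ψ₁]_β`, `Ψ₁ = (f∘H)φ·conj((f′∘H)φ′)`, for the SAME pair data `(χ₁, χ₂)` (`χ₁` UNITARY, `χ₂`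
AUTOMORPHIC) in idele-class currency; the Mellin–Parseval step (Tate's `d^×x`, ★ A Parseval with the `N = 3` shift) is PB-1b-ii.  THEOREMS ONLY (no `def`, no `instance`, no `notation`, no
named-fact hypothesis, no `sorry`; default heartbeats); lane `--supports stmt-HodgeConjecture-24833 --as helper` (count-neutral).  CLOSES NO SOCKET.

THE MATHEMATICS ([MoeglinWaldspurger1995] II.2.1; [Rogawski1990] §7.3 pp. 96–98; [TateThesis1967] §4.3).  Exactly the plumbing of ★ C4a §2 `integral_weight_smul_wOne_eq_zero_cm_three` with
`χ₁′ = χ₁`, `χ₂′ = χ₂`, but concluding with ★ (δ)₃ `exists_integral_weight_smul_eq_mul_setIntegral_ideleClass_three` INSTEAD of Lemma B: `Ψ₁` is Borel, left-`N(𝔸)`- and left-`B(L⁺)`-invariant;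
along `t·K_U` its `K_U`-average is (★ C1 `integral_maximalCompact_torus_chiSectionPair_mul_conj`) `(f·conj f′)(‖d₀t‖)·|χ₁(d₀t)|²·|χ₂(t₁₁)|²·⟪φ,φ′⟫_{K_U} = (f·conj f′)(‖d₀t‖)·⟪φ,φ′⟫_{K_U}`
(unitarity ★ `apply_mul_conj_apply_of_isUnitary`, ★ `norm_torusHom_apply_eq_one_of_isAutomorphic`), a function `Φ` of the idele `d₀t` invariant under `L^×`; majorant `‖f(‖x‖)‖·C_φ‖f′‖_∞C_{φ′}`,
finite against `(‖x‖·‖x‖)⁻¹` on `𝓕_I` (★ `setLIntegral_normSq_inv_mul_enorm_comp_lt_top`).  Hence **`[Ψ₁]_β = K·∫_{𝓕_I} (‖x‖·‖x‖)⁻¹•Φ(x) dν_I`**, `Φ(x) = f(‖x‖)·conj f′(‖x‖)·⟪φ,φ′⟫_{K_U}`,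
`K ∈ (0, ∞)` the constant of ★ (δ)₃ (depending on `(ν_G, μ_K, ν_I, 𝓕_I)` only).
* §1 **`integral_weight_smul_wOne_eq_setIntegral_ideleClass_cm_three`** — `∃ K ≠ 0, ≠ ∞` BEFORE `∀ β (pair data) (sections) (profiles)`: `Integrable (β•Ψ₁) ν_G`, `IntegrableOn ((‖·‖²)⁻¹•Φ) 𝓕_I ν_I`,
  and the identity.
HONEST LABEL: HC_CM is proved only modulo the 7 printed citations (2 remaining named inputs: hLiu418 = `stmt-HodgeConjecture-24832`, h413 = `stmt-HodgeConjecture-24833`) until rung 0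
closes; REL ≠ ★ ≠ BUILT; this file asserts no named fact and closes no socket — PB-1b-i is bookkeeping toward the XL E1-Plancherel body; count-neutral; letter-free (structural measure data only).

## References
* [MoeglinWaldspurger1995] C. Mœglin, J.-L. Waldspurger, *Spectral Decomposition and Eisenstein Series* (1995), II.2.1, IV.2.
* [Rogawski1990] J. D. Rogawski, *Automorphic Representations of Unitary Groups in Three Variables* (1990), §7.3 (pp. 96–98), §13.9 p. 229.
* [TateThesis1967] J. Tate, *Fourier analysis in number fields and Hecke's zeta-functions*, in Cassels–Fröhlich (1967), §4.3, Thm. 4.4.1.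
-/

set_option autoImplicit false
set_option linter.dupNamespace false  -- the mandated namespace repeats the summit's segment (`HodgeConjecture.HodgeConjecture`)

noncomputable section

open MeasureTheory Measure Set Filter Topology Complex NumberField IsDedekindDomain MulAction
open scoped Real NNReal ENNReal ComplexConjugate
open Literature.MeasureTheory.Group Literature.NumberTheory
open Literature.NumberTheory.Automorphic Literature.NumberTheory.Automorphic.UnitaryGroup AdelicGroupData
open Literature.NumberTheory.GaloisRepresentations (HeckeCharacter ideleGroup)
open Literature.NumberTheory.Automorphic.Arthur2013.Leaves.TECR
open Summit.HodgeConjecture.HodgeConjecture.Cruxes.H413.K2E1BorelEisensteinU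
open Summit.HodgeConjecture.HodgeConjecture.Cruxes.H413.K2E1CharacterEisensteinU2Defs
open Summit.HodgeConjecture.HodgeConjecture.Cruxes.H413.K2E1CharacterEisensteinU3PairDefs
open Summit.HodgeConjecture.HodgeConjecture.Cruxes.H413.K2E1ChiSectionTorusAverageU3 (apply_torus_mul_of_isChiSectionPair borelHeight_torus_mul_maximalCompact_three integral_maximalCompact_torus_chiSectionPair_mul_conj)
open Summit.HodgeConjecture.HodgeConjecture.Cruxes.H413.K2E1EisensteinPairingUnfoldedWeight (exists_integral_weight_smul_eq_mul_setIntegral_ideleClass_three)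
open Summit.HodgeConjecture.HodgeConjecture.Cruxes.H413.K2E1ChiPseudoEisensteinIdeleSplitCMThree
open Summit.HodgeConjecture.HodgeConjecture.Cruxes.H413.K2E1IdeleClassCharacterOrthogonality (apply_mul_conj_apply_of_isUnitary)

namespace Summit.HodgeConjecture.HodgeConjecture.Cruxes.H413.K2E1ChiPseudoEisensteinBracketOneIdeleCMThree

variable (L : Type) [Field L] [NumberField L] [IsCMField L]
variable [MeasurableSpace (quasiSplit (↥(maximalRealSubfield L)) L (IsCMField.complexConj L) 3).Adelic] [BorelSpace (quasiSplit (↥(maximalRealSubfield L)) L (IsCMField.complexConj L) 3).Adelic]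
variable [MeasurableSpace (AdeleRing (𝓞 L) L)ˣ] [BorelSpace (AdeleRing (𝓞 L) L)ˣ]

/-- **PB-1b-i — THE DIAGONAL BRACKET IN IDELE-CLASS CURRENCY.**  Structural data: Haar `ν_G` on `G(𝔸)`, `μ_K` on `K_U`, `ν_I` on `𝕀_L` with an idele class domain `𝓕_I`.  There is `K ∈ (0,∞)`
(★ (δ)₃'s constant) such that for every covering weight `β` of `B(L⁺)♯`, every UNITARY Hecke character `χ₁`, AUTOMORPHIC `U(1)`-character `χ₂`, continuous bounded pair sections `φ, φ′ ∈ (χ₁,χ₂)`,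
`f ∈ C_c((0,∞))` and `f′` continuous of compact support: `β•Ψ₁ ∈ L¹(ν_G)` (`Ψ₁ = (f∘H)φ·conj((f′∘H)φ′)`), `x ↦ (‖x‖‖x‖)⁻¹•(f(‖x‖)conj f′(‖x‖)·⟪φ,φ′⟫_{K_U})` is integrable on `𝓕_I`, and
**`∫ β•Ψ₁ dν_G = K·∫_{𝓕_I} (‖x‖‖x‖)⁻¹•(f(‖x‖)·conj f′(‖x‖)·⟪φ,φ′⟫_{K_U}) dν_I`**, `⟪φ,φ′⟫_{K_U} = ∫_{K_U} φ·conj φ′ dμ_K` (★ C4a §2's plumbing ∘ ★ (δ)₃; ★ C1 for the `K_U`-average, unitarity kills the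
characters). [cite: MoeglinWaldspurger1995, II.2.1] [cite: Rogawski1990, §7.3 (pp. 96–98)] [cite: TateThesis1967, §4.3] -/
theorem integral_weight_smul_wOne_eq_setIntegral_ideleClass_cm_three
    (νG : Measure (quasiSplit (↥(maximalRealSubfield L)) L (IsCMField.complexConj L) 3).Adelic) [νG.IsHaarMeasure] (μK : Measure ((standardMaximalCompactGL 3 L).comap (adelicVal (↥(maximalRealSubfield L)) L (IsCMField.complexConj L) 3 ((StdForm.antidiagonal 3).over L)) : Subgroup (quasiSplit (↥(maximalRealSubfield L)) L (IsCMField.complexConj L) 3).Adelic)) [μK.IsHaarMeasure] (νI : Measure (AdeleRing (𝓞 L) L)ˣ) [νI.IsHaarMeasure]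
    {𝓕I : Set (AdeleRing (𝓞 L) L)ˣ} (h𝓕I : IsIdeleClassDomain L 𝓕I) :
    ∃ K : ℝ≥0∞, K ≠ 0 ∧ K ≠ ∞ ∧
      ∀ {β : (quasiSplit (↥(maximalRealSubfield L)) L (IsCMField.complexConj L) 3).Adelic → ℝ≥0∞}, IsCoveringWeight ((arithmeticBorel (↥(maximalRealSubfield L)) L (IsCMField.complexConj L) 3).map (quasiSplit (↥(maximalRealSubfield L)) L (IsCMField.complexConj L) 3).arithmeticSubgroup.subtype) β →
      ∀ {χ₁ : HeckeCharacter L} {χ₂ : ↥(TorusDict.torus (IsCMField.complexConj L)) →ₜ* ℂˣ} {φ φ' : (quasiSplit (↥(maximalRealSubfield L)) L (IsCMField.complexConj L) 3).Adelic → ℂ},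
        χ₁.IsUnitary → TorusDict.IsAutomorphic (IsCMField.complexConj L) χ₂ →
        IsChiSectionPair χ₁ χ₂ φ → Continuous φ → ∀ {Cφ : ℝ}, (∀ x, ‖φ x‖ ≤ Cφ) →
        IsChiSectionPair χ₁ χ₂ φ' → Continuous φ' → ∀ {Cφ' : ℝ}, (∀ x, ‖φ' x‖ ≤ Cφ') →
      ∀ {f f' : ℝ → ℂ}, Continuous f → HasCompactSupport f → tsupport f ⊆ Ioi 0 → Continuous f' → HasCompactSupport f' →
        Integrable (fun g : (quasiSplit (↥(maximalRealSubfield L)) L (IsCMField.complexConj L) 3).Adelic => (β g).toReal • (f (borelHeight g : ℝ) * φ g * conj (f' (borelHeight g : ℝ) * φ' g))) νG ∧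
        IntegrableOn (fun x : (AdeleRing (𝓞 L) L)ˣ => ((IdeleClassGroup.ideleNorm L x : ℝ) * (IdeleClassGroup.ideleNorm L x : ℝ))⁻¹ • (f (IdeleClassGroup.ideleNorm L x : ℝ) * conj (f' (IdeleClassGroup.ideleNorm L x : ℝ)) * ∫ k : ((standardMaximalCompactGL 3 L).comap (adelicVal (↥(maximalRealSubfield L)) L (IsCMField.complexConj L) 3 ((StdForm.antidiagonal 3).over L)) : Subgroup (quasiSplit (↥(maximalRealSubfield L)) L (IsCMField.complexConj L) 3).Adelic), φ (k : (quasiSplit (↥(maximalRealSubfield L)) L (IsCMField.complexConj L) 3).Adelic) * conj (φ' (k : (quasiSplit (↥(maximalRealSubfield L)) L (IsCMField.complexConj L) 3).Adelic)) ∂μK)) 𝓕I νI ∧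
        ∫ g : (quasiSplit (↥(maximalRealSubfield L)) L (IsCMField.complexConj L) 3).Adelic, (β g).toReal • (f (borelHeight g : ℝ) * φ g * conj (f' (borelHeight g : ℝ) * φ' g)) ∂νG =
          (K.toReal : ℂ) * ∫ x in 𝓕I, ((IdeleClassGroup.ideleNorm L x : ℝ) * (IdeleClassGroup.ideleNorm L x : ℝ))⁻¹ • (f (IdeleClassGroup.ideleNorm L x : ℝ) * conj (f' (IdeleClassGroup.ideleNorm L x : ℝ)) * ∫ k : ((standardMaximalCompactGL 3 L).comap (adelicVal (↥(maximalRealSubfield L)) L (IsCMField.complexConj L) 3 ((StdForm.antidiagonal 3).over L)) : Subgroup (quasiSplit (↥(maximalRealSubfield L)) L (IsCMField.complexConj L) 3).Adelic), φ (k : (quasiSplit (↥(maximalRealSubfield L)) L (IsCMField.complexConj L) 3).Adelic) * conj (φ' (k : (quasiSplit (↥(maximalRealSubfield L)) L (IsCMField.complexConj L) 3).Adelic)) ∂μK) ∂νI := by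
  haveI := t2Space_adeleRing_of_numberField L
  haveI := locallyCompactSpace_adeleRing' L
  have hc : IsCMField.complexConj L * IsCMField.complexConj L = 1 := AlgEquiv.ext fun x => IsCMField.complexConj_apply_apply L x
  have hc1 : IsCMField.complexConj L ≠ 1 := IsCMField.complexConj_ne_one L
  have h2 := Algebra.IsQuadraticExtension.finrank_eq_two (↥(maximalRealSubfield L)) L
  have hBK := exists_mem_borelAdelic_mul_mem_standardMaximalCompactGL_cm L (N := 3)
  obtain ⟨K, hK0, hKt, -, hδ⟩ := exists_integral_weight_smul_eq_mul_setIntegral_ideleClass_three h2 hc hc1 νG μK νI hBK h𝓕I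
  refine ⟨K, hK0, hKt, ?_⟩
  intro β hβ χ₁ χ₂ φ φ' hχ₁u hχ₂ hφ hφc Cφ hφC hφ' hφ'c Cφ' hφ'C f f' hf hfs hf0 hf' hf's
  have hIc : Continuous fun x : (AdeleRing (𝓞 L) L)ˣ => (IdeleClassGroup.ideleNorm L x : ℝ) := NNReal.continuous_coe.comp (continuous_ideleNorm_holds L)
  have hHc : Continuous fun g : (quasiSplit (↥(maximalRealSubfield L)) L (IsCMField.complexConj L) 3).Adelic => (borelHeight g : ℝ) := NNReal.continuous_coe.comp continuous_borelHeight
  have hCφ : 0 ≤ Cφ := (norm_nonneg _).trans (hφC 1)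
  obtain ⟨B', hB'⟩ := hf's.exists_bound_of_continuous hf'
  have hB'0 : 0 ≤ B' := (norm_nonneg _).trans (hB' 1)
  have hφB := (K2E1BorelCosetsDictionary.forall_arithmeticBorel_iff (ψ := φ)).2 (hφ.toAdelic_mul hχ₂)
  have hφ'B := (K2E1BorelCosetsDictionary.forall_arithmeticBorel_iff (ψ := φ')).2 (hφ'.toAdelic_mul hχ₂)
  have hHtk := borelHeight_torus_mul_maximalCompact_three (F := ↥(maximalRealSubfield L)) (E := L) (c := IsCMField.complexConj L)
  have hn2 : ∀ u : ↥(TorusDict.torus (IsCMField.complexConj L)), ‖((χ₂ u : ℂˣ) : ℂ)‖ = 1 :=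
    norm_torusHom_apply_eq_one_of_isAutomorphic (↥(maximalRealSubfield L)) L (IsCMField.complexConj L) h2 hc1 χ₂ hχ₂
  have hχ₁1 : ∀ a : (AdeleRing (𝓞 L) L)ˣ, ((χ₁ a : ℂˣ) : ℂ) * conj ((χ₁ a : ℂˣ) : ℂ) = 1 := fun a => by
    rw [apply_mul_conj_apply_of_isUnitary χ₁ hχ₁u, mul_inv_cancel]; rfl
  have hχ₂1 : ∀ u : ↥(TorusDict.torus (IsCMField.complexConj L)), ((χ₂ u : ℂˣ) : ℂ) * conj ((χ₂ u : ℂˣ) : ℂ) = 1 := fun u => by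
    rw [Complex.mul_conj', hn2]; norm_num
  exact hδ β hβ
    (fun g : (quasiSplit (↥(maximalRealSubfield L)) L (IsCMField.complexConj L) 3).Adelic => f (borelHeight g : ℝ) * φ g * conj (f' (borelHeight g : ℝ) * φ' g))
    ((((hf.comp hHc).measurable).mul hφc.measurable).mul (continuous_conj.measurable.comp (((hf'.comp hHc).measurable).mul hφ'c.measurable)))
    (fun n y => by
      have hn := (mem_unipotentInBorel_iff _).1 n.2
      simp only [borelHeight_unipotent_mul hn, hφ.unipotent_mul ⟨_, hn⟩ y, hφ'.unipotent_mul ⟨_, hn⟩ y])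
    (fun b hb y => by
      simp only [K2E1TruncatedEisensteinExplicit.borelHeight_arithmeticBorel_mul hb, hφB b hb y, hφ'B b hb y])
    (fun x : (AdeleRing (𝓞 L) L)ˣ => f (IdeleClassGroup.ideleNorm L x : ℝ) * conj (f' (IdeleClassGroup.ideleNorm L x : ℝ)) * ∫ k : ((standardMaximalCompactGL 3 L).comap (adelicVal (↥(maximalRealSubfield L)) L (IsCMField.complexConj L) 3 ((StdForm.antidiagonal 3).over L)) : Subgroup (quasiSplit (↥(maximalRealSubfield L)) L (IsCMField.complexConj L) 3).Adelic), φ (k : (quasiSplit (↥(maximalRealSubfield L)) L (IsCMField.complexConj L) 3).Adelic) * conj (φ' (k : (quasiSplit (↥(maximalRealSubfield L)) L (IsCMField.complexConj L) 3).Adelic)) ∂μK)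
    ((((hf.comp hIc).measurable).mul (continuous_conj.measurable.comp (hf'.comp hIc).measurable)).mul measurable_const)
    (fun k hk x => by simp only [map_mul, ideleNorm_principal hk, one_mul])
    (fun t => by
      rw [integral_maximalCompact_torus_chiSectionPair_mul_conj μK hφ hφ' f f' t, hχ₁1, hχ₂1]
      ring)
    (fun x : (AdeleRing (𝓞 L) L)ˣ => ‖f (IdeleClassGroup.ideleNorm L x : ℝ)‖ₑ * ENNReal.ofReal (Cφ * (B' * Cφ')))
    ((hf.comp hIc).measurable.enorm.mul_const _) (fun k hk x => by simp only [map_mul, ideleNorm_principal hk, one_mul])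
    (fun t k => by
      rw [enorm_mul, enorm_mul, hHtk t k, mul_assoc, ← ofReal_norm (φ _), ← ofReal_norm (conj _), ← ENNReal.ofReal_mul (norm_nonneg _), Complex.norm_conj, norm_mul]
      exact mul_le_mul' le_rfl (ENNReal.ofReal_le_ofReal (mul_le_mul (hφC _) (mul_le_mul (hB' _) (hφ'C _) (norm_nonneg _) hB'0) (mul_nonneg (norm_nonneg _) (norm_nonneg _)) hCφ)))
    (setLIntegral_normSq_inv_mul_enorm_comp_lt_top νI h𝓕I hf hfs hf0 ENNReal.ofReal_ne_top)

end Summit.HodgeConjecture.HodgeConjecture.Cruxes.H413.K2E1ChiPseudoEisensteinBracketOneIdeleCMThree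

end
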